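import Mathlib
import HarnessLib
import Literature.MathematicalPhysics.QuantumLattice.HubbardGridCounterQuadratic

/-!
# Route `KLProgramme` — crux K3, VL child `KLRegimeVolumeLimitV17F2` (stmt-HubbardSuperconductivity-20440), (vi) scale-`0` base (blueprint v4 M4):
# DEEP-SITE ARITHMETIC OF THE GRID COUNTERTERM'S HOPPING KERNEL ACROSS NESTED TORI — fine hoppings from a deep site ARE the glued hoppings
# (cell gate-hubbard-kl, seat hubbard-kl-k3c4-p1 g11; `--supports` stmt-…-20440; companion `…TwoVolumeGridCounterGluing`)

The grid counterterm `𝒩_{K,L,N}` (`HubbardGridCounterQuadratic`) hops with the finite-range position kernel `Ǩ_L = framePosKernel L K` — a combination of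
lattice deltas at the harmonic shifts `(±m, ±n)`, `(±n, ±m)`, `m, n ≤ K.degree`.  On nested tori `L″ = b·L` (blocks of side `L`), at a fine site `x′`
that is `R`-DEEP in its block (every coordinate residue mod `L` in `[R, L − R)`) with `K.degree < R`, the fine kernel `Ǩ_{L″}(x′ − ·)` sees only sites of
the same block, at the same residue shifts as the coarse kernel: this is why the glued coarse counterterm and the fine one have IDENTICAL two-leg
kernels at deep pins (the companion file), i.e. why the counterterm's two-volume gluing defect lives within `K.degree` of the block boundaries.

* `exists_int_harmonicShift` — the eight shifts of a harmonic are ONE integer vector `s`, `|s i| ≤ max m n`, for every modulus;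
* `int_dvd_sub_sub_iff_of_deep` — one coordinate: for `X, Y < bL`, `X` `R`-deep, `|s| < R`: `bL ∣ X − Y − s` iff (`Y/L = X/L` and `L ∣ X − Y − s`);
* **`sub_eq_intCast_iff_of_deep`** — on the torus: `x′ − y′ = s (mod L″)` iff `y′ ∈ block(x′)` and `x̄′ − ȳ′ = s (mod L)`;
* **`framePosKernel_fine_eq_of_deep`** / **`…_of_deep_right`** — `Ǩ_{L″}(x′ − y′) = [same block]·Ǩ_L(x̄′ − ȳ′)` whenever `x′` (resp. `y′`) is
  `R`-deep and `K.degree < R`, for EVERY partner site.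

Everything is proved; no definition; torus level (no Grassmann algebra).  References: BGM 2003 §1.2 (2.10); Salmhofer 1999 §4.2.4 (4.59), §4.3.
-/

noncomputable section

namespace Summit.HubbardSuperconductivity.HubbardSuperconductivity.Theorems.TwoVolumeDefect

set_option linter.dupNamespace false -- summit = problem name (single-conjunct summit), D-0017

open Finset Literature.MathematicalPhysics.QuantumLattice Literature.Probability.LatticeModels

/-! ## Deep sites: fine hoppings from a deep site are the glued hoppings -/

section Deep

/-- **The eight shifts of a harmonic are ONE integer vector for every modulus**: for each `(m, n, e)` there is `s : Fin 2 → ℤ` with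
`|s i| ≤ max m n` and `harmonicShift P m n e = (s i mod P)_i` for every `P`. [folklore] -/
theorem exists_int_harmonicShift (m n : ℕ) (e : Fin 2 × Fin 2 × Fin 2) :
    ∃ s : Fin 2 → ℤ, (∀ i, (s i).natAbs ≤ max m n) ∧ ∀ P : ℕ, harmonicShift P m n e = fun i => ((s i : ℤ) : ZMod P) := by
  obtain ⟨e₁, e₂, e₃⟩ := e
  -- the two magnitudes carried by the coordinates, before signs
  set a : ℕ := if e₃ = 0 then m else n with ha
  set c : ℕ := if e₃ = 0 then n else m with hc
  have ha_le : a ≤ max m n := by rw [ha]; split_ifs; exacts [le_max_left _ _, le_max_right _ _]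
  have hc_le : c ≤ max m n := by rw [hc]; split_ifs; exacts [le_max_right _ _, le_max_left _ _]
  refine ⟨![(if e₁ = 0 then (a : ℤ) else -(a : ℤ)), (if e₂ = 0 then (c : ℤ) else -(c : ℤ))], ?_, fun P => ?_⟩
  · intro i
    fin_cases i
    · show (if e₁ = 0 then (a : ℤ) else -(a : ℤ)).natAbs ≤ max m n
      split_ifs <;> simpa using ha_le
    · show (if e₂ = 0 then (c : ℤ) else -(c : ℤ)).natAbs ≤ max m n
      split_ifs <;> simpa using hc_le
  · funext i
    unfold harmonicShift
    by_cases h3 : e₃ = 0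
    · have haP : a = m := by rw [ha, if_pos h3]
      have hcP : c = n := by rw [hc, if_pos h3]
      simp only [h3, if_true]
      fin_cases i
      · show (if e₁ = 0 then (m : ZMod P) else -(m : ZMod P)) = (((if e₁ = 0 then (a : ℤ) else -(a : ℤ)) : ℤ) : ZMod P)
        rw [haP]; split_ifs <;> push_cast <;> rfl
      · show (if e₂ = 0 then (n : ZMod P) else -(n : ZMod P)) = (((if e₂ = 0 then (c : ℤ) else -(c : ℤ)) : ℤ) : ZMod P)
        rw [hcP]; split_ifs <;> push_cast <;> rfl
    · have haP : a = n := by rw [ha, if_neg h3]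
      have hcP : c = m := by rw [hc, if_neg h3]
      simp only [h3, if_false]
      fin_cases i
      · show (if e₁ = 0 then (n : ZMod P) else -(n : ZMod P)) = (((if e₁ = 0 then (a : ℤ) else -(a : ℤ)) : ℤ) : ZMod P)
        rw [haP]; split_ifs <;> push_cast <;> rfl
      · show (if e₂ = 0 then (m : ZMod P) else -(m : ZMod P)) = (((if e₂ = 0 then (c : ℤ) else -(c : ℤ)) : ℤ) : ZMod P)
        rw [hcP]; split_ifs <;> push_cast <;> rfl

/-- **One coordinate of the deep-site arithmetic.**  Let `X, Y < b·L` be fine coordinates, `X` `R`-deep (`R ≤ X mod L`, `X mod L + R < L`) and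
`s` an integer with `|s| < R`.  Then `(bL) ∣ (X − Y − s)` iff (`Y / L = X / L` and `L ∣ (X − Y − s)`), and in that case `X − Y = s` exactly. [folklore] -/
theorem int_dvd_sub_sub_iff_of_deep {b L : ℕ} (hL : 0 < L) {X Y R : ℕ} (hX : X < b * L) (hY : Y < b * L)
    (hdeep : R ≤ X % L ∧ X % L + R < L) {s : ℤ} (hs : s.natAbs < R) :
    (((b * L : ℕ) : ℤ) ∣ (X : ℤ) - Y - s) ↔ (Y / L = X / L ∧ ((L : ℤ) ∣ (X : ℤ) - Y - s)) := by
  have hXdm : ((L : ℤ) * ((X / L : ℕ) : ℤ) + ((X % L : ℕ) : ℤ) = X) := by exact_mod_cast Nat.div_add_mod X L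
  have hYdm : ((L : ℤ) * ((Y / L : ℕ) : ℤ) + ((Y % L : ℕ) : ℤ) = Y) := by exact_mod_cast Nat.div_add_mod Y L
  have hrX : ((X % L : ℕ) : ℤ) < L := by exact_mod_cast Nat.mod_lt _ hL
  have hrY : ((Y % L : ℕ) : ℤ) < L := by exact_mod_cast Nat.mod_lt _ hL
  have hrY0 : (0 : ℤ) ≤ ((Y % L : ℕ) : ℤ) := by positivity
  have hR1 : (R : ℤ) ≤ ((X % L : ℕ) : ℤ) := by exact_mod_cast hdeep.1
  have hR2 : ((X % L : ℕ) : ℤ) + R < L := by exact_mod_cast hdeep.2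
  have hsR : -(R : ℤ) < s ∧ s < R := by omega
  -- the block index of `X` is `< b`
  have hqX : X / L < b := Nat.div_lt_of_lt_mul (by rwa [mul_comm] at hX)
  have hqX' : ((L : ℤ) * ((X / L : ℕ) : ℤ) + L ≤ ((b * L : ℕ) : ℤ)) := by
    have h : (X / L + 1) * L ≤ b * L := Nat.mul_le_mul_right _ hqX
    have h' : (((X / L + 1) * L : ℕ) : ℤ) ≤ ((b * L : ℕ) : ℤ) := by exact_mod_cast h
    push_cast at h' ⊢
    linarith
  have hY0 : (0 : ℤ) ≤ Y := by positivity
  have hYlt : (Y : ℤ) < ((b * L : ℕ) : ℤ) := by exact_mod_cast hY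
  have hLq : (0 : ℤ) ≤ (L : ℤ) * ((X / L : ℕ) : ℤ) := by positivity
  constructor
  · intro hdvd
    -- `|X − Y − s| < bL`, so the multiple is zero
    have hzero : (X : ℤ) - Y - s = 0 := by
      refine Int.eq_zero_of_dvd_of_natAbs_lt_natAbs hdvd ?_
      have h1 : (X : ℤ) - Y - s < (b * L : ℕ) := by linarith
      have h2 : -((b * L : ℕ) : ℤ) < (X : ℤ) - Y - s := by linarith
      omega
    have hYeq : (Y : ℤ) = X - s := by omega
    refine ⟨?_, ⟨0, by rw [hzero, mul_zero]⟩⟩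
    -- same block: `q·L ≤ Y < (q+1)·L` for `q = X / L`
    refine Nat.div_eq_of_lt_le ?_ ?_
    · have : ((X / L * L : ℕ) : ℤ) ≤ (Y : ℤ) := by rw [Nat.cast_mul]; linarith
      exact Nat.cast_le.mp this
    · have : (Y : ℤ) < (((X / L + 1) * L : ℕ) : ℤ) := by rw [Nat.cast_mul, Nat.cast_add, Nat.cast_one]; linarith
      exact Nat.cast_lt.mp this
  · rintro ⟨hq, hdvd⟩
    -- same block and `L ∣ (r_X − r_Y − s)` with `|r_X − r_Y − s| < L` force `X − Y = s`
    have hYdm' : ((L : ℤ) * ((X / L : ℕ) : ℤ) + ((Y % L : ℕ) : ℤ) = Y) := by rw [← hq]; exact hYdm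
    have hzero : (X : ℤ) - Y - s = 0 := by
      have hdiff : (X : ℤ) - Y = (X % L : ℕ) - (Y % L : ℕ) := by linarith
      refine Int.eq_zero_of_dvd_of_natAbs_lt_natAbs hdvd ?_
      rw [hdiff]
      have : -(L : ℤ) < ((X % L : ℕ) : ℤ) - (Y % L : ℕ) - s ∧ ((X % L : ℕ) : ℤ) - (Y % L : ℕ) - s < L := by
        constructor <;> linarith
      omega
    rw [hzero]
    exact dvd_zero _

variable {b L Lf : ℕ} [NeZero L] [NeZero Lf]

/-- **DEEP-SITE ARITHMETIC on the torus**: `L″ = b·L`, `x′` an `R`-deep fine site (every coordinate's residue mod `L` in `[R, L − R)`), `s : Fin 2 → ℤ` with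
`|s i| < R`.  Then `x′ − y′ = s (mod L″)` iff `y′` lies in the block of `x′` (same coordinate quotients by `L`) and the residues satisfy
`x̄′ − ȳ′ = s (mod L)`. [folklore] -/
theorem sub_eq_intCast_iff_of_deep (hLf : Lf = b * L) {R : ℕ} (x' y' : TorusSite 2 Lf)
    (hx : ∀ i, R ≤ (x' i).val % L ∧ (x' i).val % L + R < L) (s : Fin 2 → ℤ) (hs : ∀ i, (s i).natAbs < R) :
    (x' - y' = fun i => ((s i : ℤ) : ZMod Lf)) ↔
      ((∀ i, (y' i).val / L = (x' i).val / L) ∧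
        ((fun i => (((x' i).val : ℕ) : ZMod L)) - (fun i => (((y' i).val : ℕ) : ZMod L)) = fun i => ((s i : ℤ) : ZMod L))) := by
  have hL : 0 < L := Nat.pos_of_ne_zero (NeZero.ne L)
  -- coordinatewise reformulation through divisibility
  have hcoordF : ∀ i, (x' i - y' i = ((s i : ℤ) : ZMod Lf)) ↔ ((Lf : ℤ) ∣ ((x' i).val : ℤ) - (y' i).val - s i) := by
    intro i
    have hcast : (((((x' i).val : ℕ) : ℤ) - (y' i).val - s i : ℤ) : ZMod Lf) = x' i - y' i - ((s i : ℤ) : ZMod Lf) := by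
      push_cast
      rw [ZMod.natCast_zmod_val, ZMod.natCast_zmod_val]
    rw [← sub_eq_zero, ← hcast, ZMod.intCast_zmod_eq_zero_iff_dvd]
  have hcoordC : ∀ i, ((((x' i).val : ℕ) : ZMod L) - (((y' i).val : ℕ) : ZMod L) = ((s i : ℤ) : ZMod L)) ↔
      ((L : ℤ) ∣ ((x' i).val : ℤ) - (y' i).val - s i) := by
    intro i
    have hcast : (((((x' i).val : ℕ) : ℤ) - (y' i).val - s i : ℤ) : ZMod L) =
        (((x' i).val : ℕ) : ZMod L) - (((y' i).val : ℕ) : ZMod L) - ((s i : ℤ) : ZMod L) := by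
      push_cast
      rfl
    rw [← sub_eq_zero, ← hcast, ZMod.intCast_zmod_eq_zero_iff_dvd]
  have hLfZ : ((b * L : ℕ) : ℤ) = (Lf : ℤ) := by rw [hLf]
  have hval : ∀ (z : ZMod Lf), z.val < b * L := fun z => by rw [← hLf]; exact ZMod.val_lt z
  constructor
  · intro h
    have hi : ∀ i, (Lf : ℤ) ∣ ((x' i).val : ℤ) - (y' i).val - s i := fun i => (hcoordF i).1 (by
      have := congrFun h i; simpa using this)
    refine ⟨fun i => ?_, funext fun i => ?_⟩
    · exact ((int_dvd_sub_sub_iff_of_deep hL (hval _) (hval _) (hx i) (hs i)).1 (by rw [← hLf]; exact hi i)).1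
    · exact (hcoordC i).2 ((int_dvd_sub_sub_iff_of_deep hL (hval _) (hval _) (hx i) (hs i)).1 (by rw [← hLf]; exact hi i)).2
  · rintro ⟨hq, hr⟩
    funext i
    have hri := (hcoordC i).1 (by have := congrFun hr i; simpa using this)
    have hF : ((b * L : ℕ) : ℤ) ∣ ((x' i).val : ℤ) - (y' i).val - s i :=
      (int_dvd_sub_sub_iff_of_deep hL (hval _) (hval _) (hx i) (hs i)).2 ⟨hq i, hri⟩
    have := (hcoordF i).2 (by rw [← hLfZ]; exact hF)
    simpa using this

/-- **FINE HOPPINGS FROM A DEEP SITE ARE THE GLUED HOPPINGS**: for `L″ = b·L`, `K.degree < R` and an `R`-deep fine site `x′`, for EVERY fine site `y′`: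
`Ǩ_{L″}(x′ − y′) = Ǩ_L(x̄′ − ȳ′)` if `y′` lies in the block of `x′`, and `= 0` otherwise. [folklore] -/
theorem framePosKernel_fine_eq_of_deep (hLf : Lf = b * L) (K : TrigPolyC4v) {R : ℕ} (hR : K.degree < R) (x' y' : TorusSite 2 Lf)
    (hx : ∀ i, R ≤ (x' i).val % L ∧ (x' i).val % L + R < L) :
    framePosKernel Lf K (x' - y') =
      if (∀ i, (y' i).val / L = (x' i).val / L) then
        framePosKernel L K ((fun i => (((x' i).val : ℕ) : ZMod L)) - (fun i => (((y' i).val : ℕ) : ZMod L))) else 0 := by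
  classical
  rw [framePosKernel_eq_sum, framePosKernel_eq_sum]
  -- termwise in the harmonics
  have hterm : ∀ m ∈ range (K.degree + 1), ∀ n ∈ range (K.degree + 1),
      harmonicPosKernel Lf m n (x' - y') =
        if (∀ i, (y' i).val / L = (x' i).val / L) then
          harmonicPosKernel L m n ((fun i => (((x' i).val : ℕ) : ZMod L)) - (fun i => (((y' i).val : ℕ) : ZMod L))) else 0 := by
    intro m hm n hn
    have hmR : max m n < R := max_lt (lt_of_lt_of_le (mem_range.1 hm) (Nat.succ_le_of_lt hR) |>.trans_le le_rfl |> fun h => by omega)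
      (by have := mem_range.1 hn; omega)
    rw [harmonicPosKernel_eq, harmonicPosKernel_eq]
    by_cases hblk : ∀ i, (y' i).val / L = (x' i).val / L
    · rw [if_pos hblk]
      congr 1
      refine sum_congr rfl fun e _ => ?_
      obtain ⟨s, hs, hsP⟩ := exists_int_harmonicShift m n e
      have hsR : ∀ i, (s i).natAbs < R := fun i => (hs i).trans_lt hmR
      have key := sub_eq_intCast_iff_of_deep hLf x' y' hx s hsR
      rw [hsP Lf, hsP L]
      by_cases h1 : x' - y' = fun i => ((s i : ℤ) : ZMod Lf)
      · rw [if_pos h1, if_pos (key.1 h1).2]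
      · rw [if_neg h1, if_neg (fun h2 => h1 (key.2 ⟨hblk, h2⟩))]
    · rw [if_neg hblk]
      rw [mul_eq_zero]
      right
      refine sum_eq_zero fun e _ => ?_
      obtain ⟨s, hs, hsP⟩ := exists_int_harmonicShift m n e
      have hsR : ∀ i, (s i).natAbs < R := fun i => (hs i).trans_lt hmR
      rw [hsP Lf, if_neg (fun h1 => hblk ((sub_eq_intCast_iff_of_deep hLf x' y' hx s hsR).1 h1).1)]
  by_cases hblk : ∀ i, (y' i).val / L = (x' i).val / L
  · simp only [if_pos hblk] at hterm ⊢
    exact sum_congr rfl fun m hm => sum_congr rfl fun n hn => by rw [hterm m hm n hn]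
  · simp only [if_neg hblk] at hterm ⊢
    exact sum_eq_zero fun m hm => sum_eq_zero fun n hn => by rw [hterm m hm n hn, mul_zero]

/-- **The twin with the SECOND site deep**: `Ǩ_{L″}(x′ − y′) = [x′ ∈ block(y′)]·Ǩ_L(x̄′ − ȳ′)` for an `R`-deep `y′` and every `x′`. [folklore] -/
theorem framePosKernel_fine_eq_of_deep_right (hLf : Lf = b * L) (K : TrigPolyC4v) {R : ℕ} (hR : K.degree < R) (x' y' : TorusSite 2 Lf)
    (hy : ∀ i, R ≤ (y' i).val % L ∧ (y' i).val % L + R < L) :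
    framePosKernel Lf K (x' - y') =
      if (∀ i, (x' i).val / L = (y' i).val / L) then
        framePosKernel L K ((fun i => (((x' i).val : ℕ) : ZMod L)) - (fun i => (((y' i).val : ℕ) : ZMod L))) else 0 := by
  -- `Ǩ(z) ` at `z = x′ − y′ = −(y′ − x′)`: reduce to the deep-left case through the symmetry of the shift set
  classical
  rw [framePosKernel_eq_sum, framePosKernel_eq_sum]
  have hterm : ∀ m ∈ range (K.degree + 1), ∀ n ∈ range (K.degree + 1),
      harmonicPosKernel Lf m n (x' - y') =
        if (∀ i, (x' i).val / L = (y' i).val / L) then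
          harmonicPosKernel L m n ((fun i => (((x' i).val : ℕ) : ZMod L)) - (fun i => (((y' i).val : ℕ) : ZMod L))) else 0 := by
    intro m hm n hn
    have hmR : max m n < R := max_lt (by have := mem_range.1 hm; omega) (by have := mem_range.1 hn; omega)
    rw [harmonicPosKernel_eq, harmonicPosKernel_eq]
    -- for each shift `s`: `x′ − y′ = s ↔ y′ − x′ = −s`, and `−s` is again small
    have hflip : ∀ (P : ℕ) (u v : TorusSite 2 P) (s : Fin 2 → ℤ),
        (u - v = fun i => ((s i : ℤ) : ZMod P)) ↔ (v - u = fun i => (((-s i : ℤ)) : ZMod P)) := by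
      intro P u v s
      constructor
      · intro h; rw [← neg_sub, h]; funext i; simp
      · intro h; rw [← neg_sub, h]; funext i; simp
    by_cases hblk : ∀ i, (x' i).val / L = (y' i).val / L
    · rw [if_pos hblk]
      congr 1
      refine sum_congr rfl fun e _ => ?_
      obtain ⟨s, hs, hsP⟩ := exists_int_harmonicShift m n e
      have hsR : ∀ i, (-s i).natAbs < R := fun i => by rw [Int.natAbs_neg]; exact (hs i).trans_lt hmR
      have key := sub_eq_intCast_iff_of_deep hLf y' x' hy (fun i => -s i) hsR
      rw [hsP Lf, hsP L]
      by_cases h1 : x' - y' = fun i => ((s i : ℤ) : ZMod Lf)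
      · have h2 := (key.1 ((hflip Lf x' y' s).1 h1)).2
        rw [if_pos h1, if_pos ((hflip L _ _ s).2 h2)]
      · have h2 : ¬ ((fun i => (((x' i).val : ℕ) : ZMod L)) - (fun i => (((y' i).val : ℕ) : ZMod L)) = fun i => ((s i : ℤ) : ZMod L)) :=
          fun h2 => h1 ((hflip Lf x' y' s).2 (key.2 ⟨hblk, (hflip L _ _ s).1 h2⟩))
        rw [if_neg h1, if_neg h2]
    · rw [if_neg hblk, mul_eq_zero]
      right
      refine sum_eq_zero fun e _ => ?_
      obtain ⟨s, hs, hsP⟩ := exists_int_harmonicShift m n e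
      have hsR : ∀ i, (-s i).natAbs < R := fun i => by rw [Int.natAbs_neg]; exact (hs i).trans_lt hmR
      rw [hsP Lf, if_neg (fun h1 => hblk ((sub_eq_intCast_iff_of_deep hLf y' x' hy (fun i => -s i) hsR).1
        ((hflip Lf x' y' s).1 h1)).1)]
  by_cases hblk : ∀ i, (x' i).val / L = (y' i).val / L
  · simp only [if_pos hblk] at hterm ⊢
    exact sum_congr rfl fun m hm => sum_congr rfl fun n hn => by rw [hterm m hm n hn]
  · simp only [if_neg hblk] at hterm ⊢
    exact sum_eq_zero fun m hm => sum_eq_zero fun n hn => by rw [hterm m hm n hn, mul_zero]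

end Deep

end Summit.HubbardSuperconductivity.HubbardSuperconductivity.Theorems.TwoVolumeDefect

end
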